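import Mathlib
import HarnessLib
import Summits.AtomisticToContinuum.Crystallization.Theorems.PricedLinkCensusSoftLayerPropagationStubBallPropagationSteps
import Summits.AtomisticToContinuum.Crystallization.Theorems.PricedLinkCensusSoftLayerPropagationStubBallPropagationDisc

/-!
# Local layer-propagation lemmas for the finite-ball form of Hales, *Dense Sphere Packings* §1.3 (IX):
# one certified layer disc forces the next (the layer step)

Route `PricedLinkCensus`, crux `SoftLayerPropagation` (stmt-AtomisticToContinuum-14233), line
`Sketch`, ninth helper file for the stub `stub_ballPropagation` (frame `u₁, u₂, w, 𝗁 e₃` of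
`LayerShells.lean`; uses `…Steps.lean`, `…Disc.lean`).

THE LAYER STEP with its radii made explicit hypotheses.  Layer `n` of the packing is the affine
lattice `o + ℤu₁ + ℤu₂` (`o` its offset); suppose every lattice point within `ρ` of the axis foot
`c′` is a centre with shell `layerShell σ σ′` ("full").  Then (`layer_step`) every point
`o + p + σ w + 𝗁 e₃` of the next layer within `ρ′` of the axis is a centre with shell
`layerShell τ (−σ)`, provided:
* its pattern: centres of the next layer within `ρ′` have pattern shells (`hgood`);
* a full parent: `r² − 2M + 4/3 ≤ ρ²` whenever `0 ≤ r ≤ ρ′`, `0 ≤ M`, `r² ≤ 3M²` (`hpar`; of the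
  three corners of the hole under a point at distance `r` from the axis one is at squared distance
  `r² − 2M + 4/3` with such an `M`, `exists_mem_holeTriple_sub_norm_sq_eq`);
* the far corner, OUTSIDE THE FCC ZONE ONLY: either every centre of the next layer within `ρ′`
  has an FCC shell (`hzone`, no far corner needed, `…FccZone.lean`), or `ρ′ + 4/√3 ≤ R` where
  lattice points within `R` of the axis are known to be centres because they have a full hexagon
  neighbour (`hR`: for `ρ < r ≤ R` some `t > 0` has `(4/3)t² < r²` and `r² − (4t − 4) ≤ ρ²`,
  `exists_mem_hexagonSet_norm_sq_lt`).
The numbers are left to the user: for the stub (`13 → 7`) the worst case closes with about `0.4`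
to spare (see the notes of the stub worker); for `13 → 6` or `14 → 7` with room.

All statements are elementary ([folklore]).
-/

noncomputable section

namespace Summit.AtomisticToContinuum.Crystallization.Theorems

open Literature.Geometry.DiscreteGeometry Literature.MathematicalPhysics.StatisticalMechanics
open RealInnerProductSpace

/-! ### The corner of a hole nearest to the axis -/

/-- **The nearest corner of a hole.**  For a horizontal `d` and a type `τ = ±1` there are a hole
point `t ∈ holeTriple τ` and a real `M ≥ 0` with `‖d‖² ≤ 3M²` and `‖d − t‖² = ‖d‖² − 2M + 4/3`
(`M` the largest of the three inner products `⟪d, t⟫`, which sum to `0` and have squares summing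
to `2‖d‖²`, `sq_add_sq_le_five_mul_sq`): of the three corners `y − t − 𝗁e₃` of the hole under a
point `y` of the next layer, one is at horizontal squared distance `≤ r² − 2r/√3 + 4/3` from the
axis (`r` that of `y`). [folklore] -/
theorem exists_mem_holeTriple_sub_norm_sq_eq {d : EuclideanSpace ℝ (Fin 3)} (hd2 : d 2 = 0)
    {τ : ℝ} (hτ : τ = 1 ∨ τ = -1) :
    ∃ t ∈ holeTriple τ, ∃ M : ℝ, 0 ≤ M ∧ ‖d‖ ^ 2 ≤ 3 * M ^ 2 ∧ ‖d - t‖ ^ 2 = ‖d‖ ^ 2 - 2 * M + 4 / 3 := by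
  suffices key : ∀ q : EuclideanSpace ℝ (Fin 3), q 2 = 0 →
      ∃ t ∈ holeTriple 1, ∃ M : ℝ, 0 ≤ M ∧ ‖q‖ ^ 2 ≤ 3 * M ^ 2 ∧
        ‖q - t‖ ^ 2 = ‖q‖ ^ 2 - 2 * M + 4 / 3 by
    rcases hτ with rfl | rfl
    · exact key d hd2
    · obtain ⟨t, ht, M, hM0, hM, he⟩ := key (-d) (by simp [hd2])
      refine ⟨-t, neg_mem_holeTriple_iff.2 (by simpa using ht), M, hM0, by rwa [norm_neg] at hM, ?_⟩
      have e : d - -t = -(-d - t) := by abel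
      rw [e, norm_neg, he, norm_neg]
  intro q hq2
  have hs : Real.sqrt 3 ^ 2 = 3 := sqrt_three_sq
  have hn : ‖q‖ ^ 2 = q 0 ^ 2 + q 1 ^ 2 := by rw [norm_sq_fin3, hq2]; ring
  have e1 : ‖q - barlowOffset 2‖ ^ 2 =
      q 0 ^ 2 + q 1 ^ 2 - 2 * (q 0 + Real.sqrt 3 / 3 * q 1) + 4 / 3 := by
    rw [norm_sq_fin3]
    simp only [PiLp.sub_apply, frameW_apply_zero, frameW_apply_one, frameW_apply_two, hq2]
    linear_combination (1 / 9 : ℝ) * hs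
  have e2 : ‖q - (barlowOffset 2 - triangularVec₁ 2)‖ ^ 2 =
      q 0 ^ 2 + q 1 ^ 2 - 2 * (-q 0 + Real.sqrt 3 / 3 * q 1) + 4 / 3 := by
    rw [norm_sq_fin3]
    simp only [PiLp.sub_apply, frameW_apply_zero, frameW_apply_one, frameW_apply_two,
      frameU_apply_zero, frameU_apply_one, frameU_apply_two, hq2]
    linear_combination (1 / 9 : ℝ) * hs
  have e3 : ‖q - (barlowOffset 2 - triangularVec₂ 2)‖ ^ 2 =
      q 0 ^ 2 + q 1 ^ 2 - 2 * (-(2 * Real.sqrt 3 / 3) * q 1) + 4 / 3 := by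
    rw [norm_sq_fin3]
    simp only [PiLp.sub_apply, frameW_apply_zero, frameW_apply_one, frameW_apply_two,
      frameV_apply_zero, frameV_apply_one, frameV_apply_two, hq2]
    linear_combination (4 / 9 : ℝ) * hs
  have hsum : (q 0 + Real.sqrt 3 / 3 * q 1) + (-q 0 + Real.sqrt 3 / 3 * q 1) +
      (-(2 * Real.sqrt 3 / 3) * q 1) = 0 := by ring
  have hsq : (q 0 + Real.sqrt 3 / 3 * q 1) ^ 2 + (-q 0 + Real.sqrt 3 / 3 * q 1) ^ 2 +
      (-(2 * Real.sqrt 3 / 3) * q 1) ^ 2 = 2 * (q 0 ^ 2 + q 1 ^ 2) := by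
    linear_combination (2 / 3 * q 1 ^ 2) * hs
  -- the generic conclusion for the LARGEST inner product `M = x` (`−x` is the least of the negatives)
  have finish : ∀ t : EuclideanSpace ℝ (Fin 3), t ∈ holeTriple 1 → ∀ x y z : ℝ,
      ‖q - t‖ ^ 2 = q 0 ^ 2 + q 1 ^ 2 - 2 * x + 4 / 3 → x + y + z = 0 →
      x ^ 2 + y ^ 2 + z ^ 2 = 2 * (q 0 ^ 2 + q 1 ^ 2) → y ≤ x → z ≤ x →
      ∃ t ∈ holeTriple 1, ∃ M : ℝ, 0 ≤ M ∧ ‖q‖ ^ 2 ≤ 3 * M ^ 2 ∧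
        ‖q - t‖ ^ 2 = ‖q‖ ^ 2 - 2 * M + 4 / 3 := by
    intro t ht x y z he hxyz hsq' hxy hxz
    have h5 := sq_add_sq_le_five_mul_sq (x := -x) (y := -y) (z := -z) (by linarith) (by linarith)
      (by linarith)
    refine ⟨t, ht, x, by linarith, ?_, by rw [he, hn]⟩
    rw [hn]; nlinarith [h5]
  have m1 : (barlowOffset 2 : EuclideanSpace ℝ (Fin 3)) ∈ holeTriple 1 := by simp [holeTriple]
  have m2 : (barlowOffset 2 - triangularVec₁ 2 : EuclideanSpace ℝ (Fin 3)) ∈ holeTriple 1 := by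
    simp [holeTriple]
  have m3 : (barlowOffset 2 - triangularVec₂ 2 : EuclideanSpace ℝ (Fin 3)) ∈ holeTriple 1 := by
    simp [holeTriple]
  set x₁ := q 0 + Real.sqrt 3 / 3 * q 1 with hx₁
  set x₂ := -q 0 + Real.sqrt 3 / 3 * q 1 with hx₂
  set x₃ := -(2 * Real.sqrt 3 / 3) * q 1 with hx₃
  rcases le_or_gt x₂ x₁ with h12 | h12
  · rcases le_or_gt x₃ x₁ with h13 | h13
    · exact finish _ m1 x₁ x₂ x₃ e1 hsum hsq h12 h13
    · exact finish _ m3 x₃ x₁ x₂ e3 (by linarith) (by linarith) h13.le (by linarith)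
  · rcases le_or_gt x₃ x₂ with h23 | h23
    · exact finish _ m2 x₂ x₁ x₃ e2 (by linarith) (by linarith) h12.le h23
    · exact finish _ m3 x₃ x₁ x₂ e3 (by linarith) (by linarith) (by linarith) h23.le

/-! ### Lattice bookkeeping for hole points -/

/-- `τ w − t` is a lattice vector for `t ∈ holeTriple τ`. [folklore] -/
theorem exists_int_smul_frameW_sub_of_mem_holeTriple {τ : ℝ} (hτ : τ = 1 ∨ τ = -1)
    {t : EuclideanSpace ℝ (Fin 3)} (ht : t ∈ holeTriple τ) :
    ∃ a b : ℤ, τ • (barlowOffset 2 : EuclideanSpace ℝ (Fin 3)) - t =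
      (a : ℝ) • triangularVec₁ 2 + (b : ℝ) • triangularVec₂ 2 := by
  rw [mem_holeTriple_iff] at ht
  obtain ⟨t₁, ht₁, rfl⟩ := ht
  rw [mem_holeTriple_one_iff] at ht₁
  rcases hτ with rfl | rfl <;> rcases ht₁ with rfl | rfl | rfl
  · exact ⟨0, 0, by push_cast; module⟩
  · exact ⟨1, 0, by push_cast; module⟩
  · exact ⟨0, 1, by push_cast; module⟩
  · exact ⟨0, 0, by push_cast; module⟩
  · exact ⟨-1, 0, by push_cast; module⟩
  · exact ⟨0, -1, by push_cast; module⟩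

/-- `τ w + 2t` is a lattice vector for `t ∈ holeTriple τ` (the far corner `p + 3t` of the parent
`p = y − t` of a next-layer point `y = … + τ w`, horizontally `y + 2t`, is a lattice point of the
layer of `p`). [folklore] -/
theorem exists_int_smul_frameW_add_two_smul_of_mem_holeTriple {τ : ℝ} (hτ : τ = 1 ∨ τ = -1)
    {t : EuclideanSpace ℝ (Fin 3)} (ht : t ∈ holeTriple τ) :
    ∃ a b : ℤ, τ • (barlowOffset 2 : EuclideanSpace ℝ (Fin 3)) + (2 : ℝ) • t =
      (a : ℝ) • triangularVec₁ 2 + (b : ℝ) • triangularVec₂ 2 := by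
  rw [mem_holeTriple_iff] at ht
  obtain ⟨t₁, ht₁, rfl⟩ := ht
  rw [mem_holeTriple_one_iff] at ht₁
  have h3 : (3 : ℝ) • (barlowOffset 2 : EuclideanSpace ℝ (Fin 3)) = triangularVec₁ 2 + triangularVec₂ 2 :=
    three_smul_barlowOffset 2
  rcases hτ with rfl | rfl <;> rcases ht₁ with rfl | rfl | rfl
  · exact ⟨1, 1, by
      have : (1 : ℝ) • (barlowOffset 2 : EuclideanSpace ℝ (Fin 3)) + (2 : ℝ) • ((1 : ℝ) • barlowOffset 2)
          = (3 : ℝ) • barlowOffset 2 := by module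
      rw [this, h3]; push_cast; module⟩
  · exact ⟨-1, 1, by
      have : (1 : ℝ) • (barlowOffset 2 : EuclideanSpace ℝ (Fin 3)) + (2 : ℝ) • ((1 : ℝ) • (barlowOffset 2 - triangularVec₁ 2))
          = (3 : ℝ) • barlowOffset 2 - (2 : ℝ) • triangularVec₁ 2 := by module
      rw [this, h3]; push_cast; module⟩
  · exact ⟨1, -1, by
      have : (1 : ℝ) • (barlowOffset 2 : EuclideanSpace ℝ (Fin 3)) + (2 : ℝ) • ((1 : ℝ) • (barlowOffset 2 - triangularVec₂ 2))
          = (3 : ℝ) • barlowOffset 2 - (2 : ℝ) • triangularVec₂ 2 := by module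
      rw [this, h3]; push_cast; module⟩
  · exact ⟨-1, -1, by
      have : (-1 : ℝ) • (barlowOffset 2 : EuclideanSpace ℝ (Fin 3)) + (2 : ℝ) • ((-1 : ℝ) • barlowOffset 2)
          = -((3 : ℝ) • barlowOffset 2) := by module
      rw [this, h3]; push_cast; module⟩
  · exact ⟨1, -1, by
      have : (-1 : ℝ) • (barlowOffset 2 : EuclideanSpace ℝ (Fin 3)) + (2 : ℝ) • ((-1 : ℝ) • (barlowOffset 2 - triangularVec₁ 2))
          = -((3 : ℝ) • barlowOffset 2) + (2 : ℝ) • triangularVec₁ 2 := by module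
      rw [this, h3]; push_cast; module⟩
  · exact ⟨-1, 1, by
      have : (-1 : ℝ) • (barlowOffset 2 : EuclideanSpace ℝ (Fin 3)) + (2 : ℝ) • ((-1 : ℝ) • (barlowOffset 2 - triangularVec₂ 2))
          = -((3 : ℝ) • barlowOffset 2) + (2 : ℝ) • triangularVec₂ 2 := by module
      rw [this, h3]; push_cast; module⟩

/-- A hole point has norm `2/√3`: `‖t‖ ≤ 2/√3`. [folklore] -/
theorem norm_le_of_mem_holeTriple {τ : ℝ} (hτ : τ = 1 ∨ τ = -1) {t : EuclideanSpace ℝ (Fin 3)}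
    (ht : t ∈ holeTriple τ) : ‖t‖ ≤ 2 / Real.sqrt 3 := by
  have h1 : ‖t‖ ^ 2 = 4 / 3 := by rw [← real_inner_self_eq_norm_sq]; exact inner_self_of_mem_holeTriple hτ ht
  have h3 : (0 : ℝ) < Real.sqrt 3 := by positivity
  have h2 : (2 / Real.sqrt 3) ^ 2 = 4 / 3 := by rw [div_pow, sqrt_three_sq]; norm_num
  nlinarith [norm_nonneg t, div_pos two_pos h3]

/-! ### Known centres around a full disc -/

section Step

variable {V : Set (EuclideanSpace ℝ (Fin 3))}

/-- **The ring of known centres.**  Suppose every lattice point `o + p` of a layer with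
`‖p − c′‖ ≤ ρ` is a centre whose six hexagon neighbours are centres.  If for every `r` with
`ρ < r ≤ R` some `t > 0` has `(4/3)t² < r²` and `r² − (4t − 4) ≤ ρ²`, then every lattice point of the
layer with `‖p − c′‖ ≤ R` is a centre: it has a hexagon neighbour within `ρ`
(`exists_mem_hexagonSet_norm_sq_lt`).  (For `ρ ≥ 2`, `R = √3 + √(ρ² − 1) ≈ ρ + 1.7` works.)
[folklore] -/
theorem add_mem_of_ring {o c' : EuclideanSpace ℝ (Fin 3)} (hc' : c' 2 = 0) {ρ R : ℝ}
    (hfull : ∀ i j : ℤ,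
      ‖((i : ℝ) • (triangularVec₁ 2 : EuclideanSpace ℝ (Fin 3)) + (j : ℝ) • triangularVec₂ 2) - c'‖ ≤ ρ →
      o + ((i : ℝ) • (triangularVec₁ 2 : EuclideanSpace ℝ (Fin 3)) + (j : ℝ) • triangularVec₂ 2) ∈ V ∧
      ∀ x ∈ hexagonSet,
        o + ((i : ℝ) • (triangularVec₁ 2 : EuclideanSpace ℝ (Fin 3)) + (j : ℝ) • triangularVec₂ 2) + x ∈ V)
    (hR : ∀ r : ℝ, ρ < r → r ≤ R → ∃ t : ℝ, 0 < t ∧ 4 / 3 * t ^ 2 < r ^ 2 ∧ r ^ 2 - (4 * t - 4) ≤ ρ ^ 2)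
    (hρ : 0 ≤ ρ) :
    ∀ i j : ℤ,
      ‖((i : ℝ) • (triangularVec₁ 2 : EuclideanSpace ℝ (Fin 3)) + (j : ℝ) • triangularVec₂ 2) - c'‖ ≤ R →
      o + ((i : ℝ) • (triangularVec₁ 2 : EuclideanSpace ℝ (Fin 3)) + (j : ℝ) • triangularVec₂ 2) ∈ V := by
  intro i j hRij
  set p : EuclideanSpace ℝ (Fin 3) :=
    (i : ℝ) • (triangularVec₁ 2 : EuclideanSpace ℝ (Fin 3)) + (j : ℝ) • triangularVec₂ 2 with hp
  by_cases hle : ‖p - c'‖ ≤ ρ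
  · exact (hfull i j hle).1
  · push Not at hle
    obtain ⟨t, ht0, ht, hle'⟩ := hR _ hle hRij
    obtain ⟨η, hη, hlt⟩ := exists_mem_hexagonSet_norm_sq_lt (lattice_apply_two i j) hc' ht0 ht
    obtain ⟨a, b, hab⟩ := exists_int_of_mem_hexagonSet hη
    have he : p + η = ((i + a : ℤ) : ℝ) • (triangularVec₁ 2 : EuclideanSpace ℝ (Fin 3)) +
        ((j + b : ℤ) : ℝ) • triangularVec₂ 2 := by
      rw [hp, hab]; push_cast; module
    have hρ' : ‖(((i + a : ℤ) : ℝ) • (triangularVec₁ 2 : EuclideanSpace ℝ (Fin 3)) +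
        ((j + b : ℤ) : ℝ) • triangularVec₂ 2) - c'‖ ≤ ρ := by
      rw [← he]
      have h1 : ‖p + η - c'‖ ^ 2 ≤ ρ ^ 2 := by linarith
      exact (pow_le_pow_iff_left₀ (norm_nonneg _) hρ two_ne_zero).1 h1
    have hmem := (hfull (i + a) (j + b) hρ').2 (-η) (neg_mem_hexagonSet hη)
    rw [← he] at hmem
    convert hmem using 1; abel

/-! ### One certified layer disc forces the next -/

/-- **The layer step.**  Let layer `o + ℤu₁ + ℤu₂` of the packing be certified on the disc
`‖p − c′‖ ≤ ρ` (every lattice point there is a centre with shell `layerShell σ σ′`), let the ring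
hypothesis `hR` make the lattice points within `R` centres (`add_mem_of_ring`), and consider a
point `y = o + p + σ w + 𝗁 e₃` of the next layer with `‖p + σ w − c′‖ ≤ ρ′`.  If (`hpar`) one corner
of the hole under any such point is certified, the shell of `y` is a pattern (`hgood`), and either
all such shells are FCC (`hzone`) or `ρ′ + 4/√3 ≤ R` (the far corner is a known centre), then `y` is
a centre with shell `layerShell τ (−σ)` (`exists_kissingShell_above_eq_layerShell`, resp. its FCC
form). [folklore] -/
theorem layer_step (hV : IsUnitBallPacking V) {o c' : EuclideanSpace ℝ (Fin 3)} (hc' : c' 2 = 0)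
    {σ σ' : ℝ} (hσ : σ = 1 ∨ σ = -1) {ρ ρ' R : ℝ} (hρ : 0 ≤ ρ)
    (hfull : ∀ i j : ℤ,
      ‖((i : ℝ) • (triangularVec₁ 2 : EuclideanSpace ℝ (Fin 3)) + (j : ℝ) • triangularVec₂ 2) - c'‖ ≤ ρ →
      o + ((i : ℝ) • (triangularVec₁ 2 : EuclideanSpace ℝ (Fin 3)) + (j : ℝ) • triangularVec₂ 2) ∈ V ∧
      kissingShell V (o + ((i : ℝ) • (triangularVec₁ 2 : EuclideanSpace ℝ (Fin 3)) +
        (j : ℝ) • triangularVec₂ 2)) = layerShell σ σ')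
    (hR : ∀ r : ℝ, ρ < r → r ≤ R → ∃ t : ℝ, 0 < t ∧ 4 / 3 * t ^ 2 < r ^ 2 ∧ r ^ 2 - (4 * t - 4) ≤ ρ ^ 2)
    (hpar : ∀ r M : ℝ, 0 ≤ r → r ≤ ρ' → 0 ≤ M → r ^ 2 ≤ 3 * M ^ 2 → r ^ 2 - 2 * M + 4 / 3 ≤ ρ ^ 2)
    (hgood : ∀ i j : ℤ,
      ‖((i : ℝ) • (triangularVec₁ 2 : EuclideanSpace ℝ (Fin 3)) + (j : ℝ) • triangularVec₂ 2 +
          σ • barlowOffset 2) - c'‖ ≤ ρ' →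
      o + ((i : ℝ) • (triangularVec₁ 2 : EuclideanSpace ℝ (Fin 3)) + (j : ℝ) • triangularVec₂ 2 +
          σ • barlowOffset 2 + layerNormal layerSpacing) ∈ V →
      IsArrangedIn (kissingShell V (o + ((i : ℝ) • (triangularVec₁ 2 : EuclideanSpace ℝ (Fin 3)) +
          (j : ℝ) • triangularVec₂ 2 + σ • barlowOffset 2 + layerNormal layerSpacing))) fccKissingPattern ∨
        IsArrangedIn (kissingShell V (o + ((i : ℝ) • (triangularVec₁ 2 : EuclideanSpace ℝ (Fin 3)) +
          (j : ℝ) • triangularVec₂ 2 + σ • barlowOffset 2 + layerNormal layerSpacing))) hcpKissingPattern)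
    (hzone : (∀ i j : ℤ,
      ‖((i : ℝ) • (triangularVec₁ 2 : EuclideanSpace ℝ (Fin 3)) + (j : ℝ) • triangularVec₂ 2 +
          σ • barlowOffset 2) - c'‖ ≤ ρ' →
      o + ((i : ℝ) • (triangularVec₁ 2 : EuclideanSpace ℝ (Fin 3)) + (j : ℝ) • triangularVec₂ 2 +
          σ • barlowOffset 2 + layerNormal layerSpacing) ∈ V →
      IsArrangedIn (kissingShell V (o + ((i : ℝ) • (triangularVec₁ 2 : EuclideanSpace ℝ (Fin 3)) +
          (j : ℝ) • triangularVec₂ 2 + σ • barlowOffset 2 + layerNormal layerSpacing))) fccKissingPattern) ∨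
      ρ' + 4 / Real.sqrt 3 ≤ R) :
    ∀ i j : ℤ,
      ‖((i : ℝ) • (triangularVec₁ 2 : EuclideanSpace ℝ (Fin 3)) + (j : ℝ) • triangularVec₂ 2 +
          σ • barlowOffset 2) - c'‖ ≤ ρ' →
      o + ((i : ℝ) • (triangularVec₁ 2 : EuclideanSpace ℝ (Fin 3)) + (j : ℝ) • triangularVec₂ 2 +
          σ • barlowOffset 2 + layerNormal layerSpacing) ∈ V ∧
      ∃ τ : ℝ, (τ = 1 ∨ τ = -1) ∧
        kissingShell V (o + ((i : ℝ) • (triangularVec₁ 2 : EuclideanSpace ℝ (Fin 3)) +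
          (j : ℝ) • triangularVec₂ 2 + σ • barlowOffset 2 + layerNormal layerSpacing)) = layerShell τ (-σ) := by
  intro i j hr
  set L : ℤ → ℤ → EuclideanSpace ℝ (Fin 3) := fun i j =>
    (i : ℝ) • (triangularVec₁ 2 : EuclideanSpace ℝ (Fin 3)) + (j : ℝ) • triangularVec₂ 2 with hL
  set yh : EuclideanSpace ℝ (Fin 3) := L i j + σ • barlowOffset 2 with hyh
  -- the nearest corner of the hole under `y`
  have hd2 : (yh - c') 2 = 0 := by simp [hyh, hL, hc']
  obtain ⟨t, ht, M, hM0, hM, he⟩ := exists_mem_holeTriple_sub_norm_sq_eq hd2 hσ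
  obtain ⟨a, b, hab⟩ := exists_int_smul_frameW_sub_of_mem_holeTriple hσ ht
  -- the parent `P = o + (yh − t)` is a certified lattice point
  have hph : yh - t = L (i + a) (j + b) := by
    have : yh - t = L i j + (σ • barlowOffset 2 - t) := by rw [hyh]; abel
    rw [this, hab]; simp only [hL]; push_cast; module
  have hρP : ‖L (i + a) (j + b) - c'‖ ≤ ρ := by
    rw [← hph]
    have e1 : yh - t - c' = (yh - c') - t := by abel
    have h1 : ‖yh - t - c'‖ ^ 2 ≤ ρ ^ 2 := by
      rw [e1, he]
      exact hpar ‖yh - c'‖ M (norm_nonneg _) hr hM0 hM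
    exact (pow_le_pow_iff_left₀ (norm_nonneg _) hρ two_ne_zero).1 h1
  obtain ⟨hPV, hPshell⟩ := hfull (i + a) (j + b) hρP
  -- `y = P + (t + e)`
  have hy : o + (yh + layerNormal layerSpacing) = o + L (i + a) (j + b) + (t + layerNormal layerSpacing) := by
    rw [← hph]; abel
  have hyV : o + (yh + layerNormal layerSpacing) ∈ V := by
    rw [hy]
    have : t + layerNormal layerSpacing ∈ kissingShell V (o + L (i + a) (j + b)) := by
      rw [hPshell]; exact mem_layerShell_iff.2 (Or.inr (Or.inl (by simpa using ht)))
    exact this.1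
  have hpat := hgood i j hr hyV
  refine ⟨hyV, ?_⟩
  rcases hzone with hz | hRle
  · -- FCC zone: no far corner needed
    have hfcc := hz i j hr hyV
    rw [hy] at hfcc ⊢
    exact exists_kissingShell_above_eq_layerShell_fcc hV hσ hPshell hPV ht hfcc
  · -- the far corner `P + 3t = o + (yh + 2t)` is a known centre
    obtain ⟨a', b', hab'⟩ := exists_int_smul_frameW_add_two_smul_of_mem_holeTriple hσ ht
    have hfar_eq : o + L (i + a) (j + b) + (3 : ℝ) • t = o + L (i + a') (j + b') := by
      have e1 : L (i + a) (j + b) + (3 : ℝ) • t = L i j + (σ • barlowOffset 2 + (2 : ℝ) • t) := by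
        rw [← hph, hyh]; module
      rw [add_assoc, e1, hab']; simp only [hL]; push_cast; module
    have hfarR : ‖L (i + a') (j + b') - c'‖ ≤ R := by
      have e2 : L (i + a') (j + b') = yh + (2 : ℝ) • t := by
        have : L (i + a') (j + b') = L i j + (σ • barlowOffset 2 + (2 : ℝ) • t) := by
          rw [hab']; simp only [hL]; push_cast; module
        rw [this, hyh]; abel
      rw [e2]
      have e3 : yh + (2 : ℝ) • t - c' = (yh - c') + (2 : ℝ) • t := by abel
      rw [e3]
      calc ‖yh - c' + (2 : ℝ) • t‖ ≤ ‖yh - c'‖ + ‖(2 : ℝ) • t‖ := norm_add_le _ _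
        _ ≤ ρ' + 4 / Real.sqrt 3 := by
            rw [norm_smul, Real.norm_of_nonneg zero_le_two]
            have := norm_le_of_mem_holeTriple hσ ht
            have h4 : 2 * ‖t‖ ≤ 4 / Real.sqrt 3 := by
              calc 2 * ‖t‖ ≤ 2 * (2 / Real.sqrt 3) := by linarith
                _ = 4 / Real.sqrt 3 := by ring
            linarith
        _ ≤ R := hRle
    have hhex : ∀ i j : ℤ, ‖L i j - c'‖ ≤ ρ → o + L i j ∈ V ∧ ∀ x ∈ hexagonSet, o + L i j + x ∈ V :=
      fun i j h => ⟨(hfull i j h).1, add_mem_of_kissingShell_eq_layerShell (hfull i j h).2⟩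
    have hfarV : o + L (i + a') (j + b') ∈ V := add_mem_of_ring hc' hhex hR hρ (i + a') (j + b') hfarR
    rw [← hfar_eq] at hfarV
    rw [hy] at hpat ⊢
    exact exists_kissingShell_above_eq_layerShell hV hσ hPshell hPV ht hfarV hpat

end Step

/-- **Registered sub-goal `ballPropagation_nearestCorner`** of the crux item (the nearest corner of a hole, in closed form: `exists_mem_holeTriple_sub_norm_sq_eq`). [folklore] -/
theorem ballPropagation_nearestCorner :
    ∀ (d : EuclideanSpace ℝ (Fin 3)), d 2 = 0 → ∀ (τ : ℝ), (τ = 1 ∨ τ = -1) → ∃ t ∈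
    Literature.Geometry.DiscreteGeometry.holeTriple τ, ∃ M : ℝ, 0 ≤ M ∧ ‖d‖ ^ 2 ≤ 3 * M ^ 2 ∧ ‖d -
    t‖ ^ 2 = ‖d‖ ^ 2 - 2 * M + 4 / 3 :=
  fun _ hd2 _ hτ => exists_mem_holeTriple_sub_norm_sq_eq hd2 hτ

end Summit.AtomisticToContinuum.Crystallization.Theorems

end
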